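import Literature.NumberTheory.EllipticCurves.ModPImageTransvectionCriterionProofs
import Literature.NumberTheory.GaloisRepresentations.SmallImageScalarGL2FpProofs
import HarnessLib

/-!
# A non-trivial scalar in the mod-`p` image at an irreducible, non-surjective prime (`E/ℚ`, `p ≥ 5`)

Topic `NumberTheory/EllipticCurves`; theorems only. Elliptic-curve form of
`Serre1972.exists_mat_eq_smul_one_ne_one` (`SmallImageScalarGL2FpProofs`), the group-theoretic core
of the cell memo `pub/bsd-smallim/koly/KOLY-MEMO.md`, Lemma 2.3:

**Theorem** (`WeierstrassCurve.exists_galoisRepTorsion_eq_smul_of_not_surjective`). Let `E = W/ℚ`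
be an elliptic curve and `p ≥ 5` a prime with `E[p]` irreducible and `ρ̄_{E,p}` NOT surjective. Then
some `σ ∈ Γ_ℚ` acts on `E[p]` as multiplication by a scalar `a ∈ 𝔽_p`, `a ≠ 1`.

Proof: in a frame `E[p] ≅ 𝔽_p²` the image `G = ρ̄(Γ_ℚ)` has surjective determinant (Weil pairing:
`det ρ̄ = χ̄_p`), fixes no line (irreducibility), is proper (non-surjectivity), hence has order prime
to `p` (Serre's Prop. 15), and contains the image of complex conjugation (an involution of
determinant `-1`); apply `exists_mat_eq_smul_one_ne_one`.

Why it matters (memo Lemma 2.3 (b)–(c)): the Teichmüller lift of `a·1` is a scalar `≢ 1 (mod p)` in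
`ρ_{E,p^∞}(Γ_ℚ)`, whence `H¹(ℚ(E[p^∞])/ℚ, E[p^k]) = 0` (Sah) — Mazur–Rubin's (H.3), Howard's H.2 —
and the Castella–Grossi–Lee–Skinner error term `C₁` vanishes, at EVERY irreducible non-surjective
prime `p ≥ 5`.

## References

* [Serre1972] J.-P. Serre, Invent. Math. 15 (1972), §2.4 Prop. 15, §2.6.
* [CastellaGrossiLeeSkinner2022] F. Castella, G. Grossi, J. Lee, C. Skinner, Invent. Math. 227
  (2022), §3.3 (error term `C₁`; "if `ρ_E` is surjective, then clearly `C₁ = 0`").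
-/

noncomputable section

open scoped Classical
open Matrix Field

namespace WeierstrassCurve

open Literature.NumberTheory.EllipticCurves Literature.NumberTheory.GaloisRepresentations
  Literature.NumberTheory.GaloisRepresentations.Serre1972

variable (W : WeierstrassCurve ℚ) [W.IsElliptic] (p : ℕ) [Fact p.Prime]

/-- **A Galois element acting on `E[p]` by a non-trivial scalar** exists as soon as `p ≥ 5`,
`E[p]` is irreducible and `ρ̄_{E,p}` is not surjective (normaliser-of-Cartan and `𝔖₄` images
alike): the image has order prime to `p` (Serre Prop. 15), surjective determinant, no common
eigenvector and an involution of determinant `-1`, so `Serre1972.exists_mat_eq_smul_one_ne_one`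
applies. This is the input that makes the error term `C₁` of Castella–Grossi–Lee–Skinner vanish
and `H¹(ℚ(E[p^∞])/ℚ, E[p]) = 0` automatic at small image (memo Lemma 2.3).
[cite: Serre1972, §2.4 Prop. 15 and §2.6] [cite: CastellaGrossiLeeSkinner2022, §3.3 (error term C₁)] -/
theorem exists_galoisRepTorsion_eq_smul_of_not_surjective (hp5 : 5 ≤ p)
    (hirr : W.HasIrreducibleModPGaloisRep p) (hns : ¬ W.HasSurjectiveModNGaloisRep p) :
    ∃ (σ : absoluteGaloisGroup ℚ) (a : ZMod p), a ≠ 1 ∧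
      ∀ x : geomTorsion W p, Multiplicative.toAdd (galoisRepTorsion W p σ) x = a.val • x := by
  obtain ⟨e, Φ, he, -, -, -, -⟩ := exists_frame_galoisRepTorsion_rat W p
  set G : Subgroup (GL (Fin 2) (ZMod p)) := (galoisRepTorsion W p).range.map Φ.toMonoidHom
    with hG
  have hGtop : G ≠ ⊤ := fun h => hns ((map_range_galoisRepTorsion_eq_top_iff W p Φ).mp h)
  have hdetG : ∀ u : (ZMod p)ˣ, ∃ g ∈ G, Matrix.GeneralLinearGroup.det g = u :=
    exists_mem_map_range_det_eq W p Φ e he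
  have hirrG : ∀ (v : Fin 2 → ZMod p) (hv : v ≠ 0), ¬ G ≤ eigenvectorStabilizer v hv :=
    fun v hv => not_le_eigenvectorStabilizer_of_hasIrreducibleModPGaloisRep W p Φ e he hirr hv
  have hcard : ¬ p ∣ Nat.card G :=
    not_dvd_natCard_of_forall_not_le_eigenvectorStabilizer G hdetG hGtop hirrG
  obtain ⟨c, hcG, hcc, hcdet⟩ := exists_conj_mem_map_range W p Φ e he
  obtain ⟨z, a, ha1, hz⟩ := exists_mat_eq_smul_one_ne_one G hp5 hcard hdetG hirrG hcG hcc hcdet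
  -- `z = Φ(ρ̄ σ)` for some `σ`
  obtain ⟨g, ⟨σ, rfl⟩, hgz⟩ := z.2
  refine ⟨σ, a, ha1, fun x => e.injective ?_⟩
  have hΦ : Φ (galoisRepTorsion W p σ) = z.1 := hgz
  have hmat : ((Φ (galoisRepTorsion W p σ) : GL (Fin 2) (ZMod p)) :
      Matrix (Fin 2) (Fin 2) (ZMod p)) = a • 1 := by
    rw [hΦ]
    exact hz
  rw [he, hmat, Matrix.smul_mulVec, Matrix.one_mulVec, map_nsmul,
    ← Nat.cast_smul_eq_nsmul (ZMod p) a.val (e x), ZMod.natCast_zmod_val]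

end WeierstrassCurve
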